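import Literature.NumberTheory.Automorphic.Liu2021.AppendixC.BettiPinningHeckeEndomorphism
import Literature.NumberTheory.Automorphic.Liu2021.AppendixC.EtaleHeckeDatumOfTranslates
import HarnessLib

/-!
# [Liu 2021, §4.2 l. 2074] the Hecke OPERATOR `[KgK]` on the ÉTALE tower at level `K` is `ᵗV_ℓ` of an HONEST endomorphism of `A_K`,
# up to a non-zero integer — the étale twin of ★ `BettiPinningHeckeEndomorphism` (no Betti pinning)

Topic `NumberTheory/Automorphic/Liu2021/AppendixC`; namespace `Literature.NumberTheory.Automorphic.Liu2021.AppendixC.Sec42Data.HeckeTranslates`.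
THEOREMS ONLY (no definition, no named fact, no instance, no `sorry`).  Inputs, all landed: the Hecke translates' calculus (`albTr_mul`,
`albTr_self`, `albTr_eq_of_coe_eq`, `C5.SmallLevel.exists_normal_le_forall_heckeLE`, `Sec42Data.BettiPinning.finite_orbit_level` — the
pinning-free §1 of ★ `BettiPinningHeckeEndomorphism`), the étale Hecke action INDUCED by the translates (★ `EtaleHeckeDatumOfTranslates`:
`etHeckeRep`, `etHecke_toTower`, `etHeckeRep_toTower_of_mem`, `Sec42Data.toTower_pull`), the tree's Hecke-operator kit
(`Automorphic.heckeOperator ρ K g = Σ_{yK ⊆ KgK} ρ(y)` on `K`-fixed vectors, ★ `heckeOperator_apply_eq_sum_out`), and the additivity of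
`V_ℓ` (★ `rationalTateModuleMap_add`).  The one hypothesis is row (D), `T.IsogenyDescent` (descent of `K`-invariant homomorphisms up to
isogeny; a THEOREM for the unitary Shimura curve tower: ★ `isogenyDescent_GS`).

## What is proved

**`exists_hom_toTower_dualMap_eq_smul_heckeOperator (hD : T.IsogenyDescent) (K) (g)`** — for every small level `K` and every
`g ∈ 𝔾(𝔸_F^∞)` there are an integer `m ≠ 0` and an HONEST endomorphism `ψ : A_K ⟶ A_K` over `E` such that for every linear form
`φ` on `V_ℓ(A_K)`:

  `[ᵗV_ℓ(ψ) φ]_K = m • [KgK] [φ]_K`  in `H¹_ét(A_∞ ⊗_E Ē, ℚ_ℓ)`,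

where `[·]_K = Sec42Data.toTower ℓ K` and `[KgK] = Automorphic.heckeOperator (T.etHeckeRep ℓ) K g`.  Proof = the Betti proof transposed:
pick `N ⊆ K` normal in `K` and admissible for a transversal `γ` of `KgK/K`; the homomorphism `Φ := Σ_γ Alb(T_γ) : A_N → A_K` is
`K`-invariant; (D) gives `Alb_{u^N_K} ≫ ψ = m • Φ`; read on linear forms: `[ᵗV(ψ) φ]_K = [ᵗV(Alb_u ≫ ψ) φ]_N = m • Σ_γ [ᵗV(Alb T_γ) φ]_N
= m • Σ_γ γ·[φ]_K = m • [KgK][φ]_K` (`etHecke_toTower`, `toTower_pull`).  Also the pointwise-in-`R ⊗` corollary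
`exists_hom_toTower_dualMap_baseChange_eq_smul_heckeOperator`.

DICTIONARY LINE (cell `hodgecm-mathlib`, crux `HLiu418` = stmt-HodgeConjecture-24832, d6 HOME card `A-plan/d6/D6-LINE-CARD.A-plan2g11.md`
S2′ clause 3 / DEF request DH1 `heckeEnd K g := m⁻¹ • ψ_g`): the étale Hecke datum of the curve tower is `etaleHeckeDatumGS :=
etaleHeckeDatumOfTranslates …`, so `rhoEt = etHeckeRep` definitionally and this theorem applies with `hD := isogenyDescent_GS` and zero
adapters: every Hecke operator on the level-`K` étale forms is `m⁻¹ · ᵗV_ℓ(ψ)` for an endomorphism `ψ` of `Alb X_K` — «the Hecke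
correspondences provide a homomorphism `𝔾(𝔸_F^∞) → Aut_E(A_∞)`» ([Liu2021] l. 2074) at finite level; the projector `u = a · e_lab` of S2′
is a `ℤ`-combination of such `ψ`'s.  The file moves no book (HC_CM is proved only modulo the 7 printed citations until rung 0 closes).

## References
* [Liu2021] Y. Liu, *Fourier–Jacobi cycles and arithmetic relative trace formula*, Camb. J. Math. 9 (2021) = arXiv:2102.11518: §4.2
  (FJcycle.tex l. 2070–2081, esp. l. 2074), Thm. 4.18 (1) with proof (l. 2239, l. 2248–2270).
* [Milne2005ShimuraVarieties] J. Milne, *Introduction to Shimura varieties*, §13 p. 118 (the translates `T(g)`), §5 p. 58 (composition).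
* [Bump1997] D. Bump, *Automorphic Forms and Representations* (1997), §4.2 Prop. 4.2.3 (`[KgK]` as a sum over `KgK/K`).
-/

set_option autoImplicit false

noncomputable section

open CategoryTheory NumberField Function MulAction
open scoped TensorProduct

namespace Literature.NumberTheory.Automorphic.Liu2021.AppendixC

open Literature.AlgebraicGeometry.Motives (AbelianVariety)
open Literature.AlgebraicGeometry.Motives.AbelianVariety (rationalTateModuleMap rationalTateModuleMap_comp rationalTateModuleMap_add)

variable {F E : Type} [Field F] [NumberField F] [IsTotallyReal F] [Field E] [NumberField E] [Algebra F E]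
  [IsTotallyComplex E] [Algebra.IsQuadraticExtension F E]
variable {P5 : PropC5Data F E} {isotropicAt : ℕ → Prop}

namespace Sec42Data.HeckeTranslates

variable {C : Sec42Data P5 isotropicAt} (T : C.HeckeTranslates) (ℓ : ℕ) [Fact ℓ.Prime]

/-- **The Hecke operator `[KgK]` on the level-`K` étale forms is `ᵗV_ℓ` of an honest endomorphism of `A_K`, up to a non-zero integer**
— granted descent up to isogeny (row (D)): for every small level `K` and every `g` there are `m ≠ 0` and `ψ : A_K ⟶ A_K` with
`[ᵗV_ℓ(ψ) φ]_K = m • [KgK] [φ]_K` for all linear forms `φ` on `V_ℓ(A_K)` (`[·]_K = toTower K`, `[KgK]` the Hecke operator of the induced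
étale action `etHeckeRep`).  Étale twin of ★ `BettiPinning.exists_hom_b_bettiPullAlong_eq_smul_heckeOperator`, with `b_K ↦ toTower K`,
the pinning's Hecke law ↦ `etHecke_toTower`, `b_bettiPullAlong_Atr ↦ toTower_pull`.
[cite: Liu2021, §4.2 (FJcycle.tex l. 2074) and Thm. 4.18 (1) proof (l. 2248–2270)] [cite: Bump1997, §4.2 (Prop. 4.2.3, proof)] -/
theorem exists_hom_toTower_dualMap_eq_smul_heckeOperator (hD : T.IsogenyDescent) (K : C5.SmallLevel C.S.K₀) (g : C.G) :
    ∃ (m : ℤ) (ψ : C.A K ⟶ C.A K), m ≠ 0 ∧ ∀ φ : C.etaleH1 ℓ K,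
      C.toTower ℓ K ((rationalTateModuleMap ℓ ψ).dualMap φ) =
        (m : ℚ_[ℓ]) • Literature.NumberTheory.Automorphic.heckeOperator (T.etHeckeRep ℓ) (K.1.1 : Subgroup C.G) g (C.toTower ℓ K φ) := by
  classical
  -- the finite set of cosets `γK ⊆ KgK` and representatives
  have hfin := Sec42Data.BettiPinning.finite_orbit_level K g
  haveI : Fintype (orbit K.1.1 (g : C.G ⧸ (K.1.1 : Subgroup C.G))) := hfin.fintype
  let rep : orbit K.1.1 (g : C.G ⧸ (K.1.1 : Subgroup C.G)) → C.G := fun α => (α.1).out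
  -- a common admissible normal source level
  obtain ⟨N, hNK, hN, hγ⟩ := C5.SmallLevel.exists_normal_le_forall_heckeLE (Finset.univ.image rep) K
  have hrep : ∀ α, C5.HeckeLE (rep α) N K := fun α => hγ _ (Finset.mem_image_of_mem rep (Finset.mem_univ α))
  -- the translates as a function on the cosets, and their sum
  let a : orbit K.1.1 (g : C.G ⧸ (K.1.1 : Subgroup C.G)) → (C.A N ⟶ C.A K) := fun α => T.albTr (rep α) N K (hrep α)
  have hka : ∀ (k : C.G) (hk : k ∈ K.1.1) (α : orbit K.1.1 (g : C.G ⧸ (K.1.1 : Subgroup C.G))),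
      T.albTr k N N (hN k hk) ≫ a α = a ((⟨k, hk⟩ : K.1.1) • α) := by
    intro k hk α
    rw [T.albTr_mul k (rep α) (hN k hk) (hrep α)]
    refine T.albTr_eq_of_coe_eq _ _ ?_
    have h1 : ((k * rep α : C.G) : C.G ⧸ (K.1.1 : Subgroup C.G)) = ((⟨k, hk⟩ : K.1.1) • α : orbit K.1.1 _).1 := by
      rw [orbit.coe_smul, ← QuotientGroup.out_eq' α.1]
      rfl
    rw [h1]
    exact (QuotientGroup.out_eq' _).symm
  let Φ : C.A N ⟶ C.A K := ∑ α, a α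
  have hΦ : ∀ (k : C.G) (hk : k ∈ K.1.1), T.albTr k N N (hN k hk) ≫ Φ = Φ := by
    intro k hk
    show T.albTr k N N (hN k hk) ≫ ∑ α, a α = ∑ α, a α
    rw [Preadditive.comp_sum]
    exact (Finset.sum_congr rfl fun α _ => hka k hk α).trans (Equiv.sum_comp (MulAction.toPerm (⟨k, hk⟩ : K.1.1)) a)
  -- descent up to isogeny
  obtain ⟨m, ψ, hm, hψ⟩ := hD hNK hN (C.A K) Φ hΦ
  refine ⟨m, ψ, hm, fun φ => ?_⟩
  -- `V_ℓ` is additive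
  let Vh : (C.A N ⟶ C.A K) →+ ((C.A N).rationalTateModule ℓ →ₗ[ℚ_[ℓ]] (C.A K).rationalTateModule ℓ) :=
    AddMonoidHom.mk' (fun f => rationalTateModuleMap ℓ f) (rationalTateModuleMap_add ℓ)
  -- read `Alb_u ≫ ψ = m • Φ` on linear forms and push into the tower
  have h1 : C.toTower ℓ K ((rationalTateModuleMap ℓ ψ).dualMap φ) =
      C.toTower ℓ N ((rationalTateModuleMap ℓ (C.Atr (homOfLE hNK) ≫ ψ)).dualMap φ) := by
    rw [rationalTateModuleMap_comp, ← LinearMap.dualMap_comp_dualMap, LinearMap.comp_apply, C.toTower_pull ℓ (homOfLE hNK)]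
  have h2 : (rationalTateModuleMap ℓ (C.Atr (homOfLE hNK) ≫ ψ)).dualMap φ =
      (m : ℚ_[ℓ]) • ∑ α, (rationalTateModuleMap ℓ (a α)).dualMap φ := by
    rw [hψ]
    have e1 : rationalTateModuleMap ℓ (m • Φ) = m • ∑ α, rationalTateModuleMap ℓ (a α) := by
      show Vh (m • ∑ α, a α) = _
      rw [map_zsmul, map_sum]
      rfl
    apply LinearMap.ext
    intro v
    rw [LinearMap.dualMap_apply, e1, LinearMap.smul_apply, LinearMap.sum_apply, map_zsmul, map_sum, LinearMap.smul_apply,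
      LinearMap.sum_apply, ← Int.cast_smul_eq_zsmul ℚ_[ℓ] m]
    congr 1
  have h3 : ∀ α, C.toTower ℓ N ((rationalTateModuleMap ℓ (a α)).dualMap φ) = T.etHeckeRep ℓ (rep α) (C.toTower ℓ K φ) := fun α =>
    (T.etHecke_toTower ℓ (rep α) (hrep α) φ).symm
  rw [h1, h2, map_smul, map_sum]
  simp_rw [h3]
  congr 1
  -- the sum over the cosets is the Hecke operator
  have hfix : C.toTower ℓ K φ ∈ (T.etHeckeRep ℓ).fixedPoints (K.1.1 : Subgroup C.G) :=
    ((T.etHeckeRep ℓ).mem_fixedPoints K.1.1 (C.toTower ℓ K φ)).2 fun _ hk => T.etHeckeRep_toTower_of_mem ℓ hk φ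
  rw [Literature.NumberTheory.Automorphic.heckeOperator_apply_eq_sum_out (T.etHeckeRep ℓ) (K.1.1 : Subgroup C.G) g hfin hfix,
    ← Finset.sum_coe_sort hfin.toFinset]
  exact Fintype.sum_equiv (Equiv.subtypeEquivRight fun x => hfin.mem_toFinset.symm) _ _ fun α => rfl

/-- **Base-changed form** (for the values of `f′ ∈ omegaHom`, which live in `R ⊗ H¹_ét`, `R = ℚ_ℓ^{ac}`): with the same `m, ψ`,
`(1 ⊗ [·]_K) ((1 ⊗ ᵗV_ℓ ψ) x) = m • (1 ⊗ [KgK]) ((1 ⊗ [·]_K) x)` for every `x ∈ R ⊗ (V_ℓ A_K)^∨`.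
[cite: Liu2021, §4.2 (FJcycle.tex l. 2074, 2160–2165)] -/
theorem exists_hom_toTower_dualMap_baseChange_eq_smul_heckeOperator (hD : T.IsogenyDescent) (K : C5.SmallLevel C.S.K₀)
    (g : C.G) (R : Type) [CommRing R] [Algebra ℚ_[ℓ] R] :
    ∃ (m : ℤ) (ψ : C.A K ⟶ C.A K), m ≠ 0 ∧ ∀ x : R ⊗[ℚ_[ℓ]] C.etaleH1 ℓ K,
      (C.toTower ℓ K).baseChange R (((rationalTateModuleMap ℓ ψ).dualMap).baseChange R x) =
        (m : ℚ_[ℓ]) • (Literature.NumberTheory.Automorphic.heckeOperator (T.etHeckeRep ℓ) (K.1.1 : Subgroup C.G) g).baseChange R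
          ((C.toTower ℓ K).baseChange R x) := by
  obtain ⟨m, ψ, hm, h⟩ := T.exists_hom_toTower_dualMap_eq_smul_heckeOperator ℓ hD K g
  refine ⟨m, ψ, hm, fun x => ?_⟩
  have hcomp : C.toTower ℓ K ∘ₗ (rationalTateModuleMap ℓ ψ).dualMap =
      (m : ℚ_[ℓ]) • (Literature.NumberTheory.Automorphic.heckeOperator (T.etHeckeRep ℓ) (K.1.1 : Subgroup C.G) g ∘ₗ C.toTower ℓ K) :=
    LinearMap.ext fun φ => by simpa only [LinearMap.coe_comp, comp_apply, LinearMap.smul_apply] using h φ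
  have := congrArg (fun (L : C.etaleH1 ℓ K →ₗ[ℚ_[ℓ]] C.etaleH1Tower ℓ) => (L.baseChange R) x) hcomp
  simpa only [LinearMap.baseChange_comp, LinearMap.comp_apply, LinearMap.baseChange_smul, LinearMap.smul_apply] using this

end Sec42Data.HeckeTranslates

end Literature.NumberTheory.Automorphic.Liu2021.AppendixC

end
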